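import Summits.QuantumFields.QCD.Theses.QuarksAsStableAction
import Literature.Analysis.Matrix.HadamardInequality

/-!
# Hadamard bound for `det (1 + K)` with `K` supported on a block of columns
(helper for crux stmt-QuantumFields-9737 `QuarksAsStableAction.StableActionBridge`, line `Sketch`,
card `sylvester-defect-floor`; stubs `norm_det_one_add_le_of_supported`,
`norm_det_one_add_le_of_supported_of_entry_le`)

This is the Hadamard step of the Sylvester-defect lever
`|det D[U]| ≤ |det D[U′]| · |det (1 + χ V D′⁻¹ χ)|` (the identity is landed as
`det_wilsonDirac_eq_det_mul_det_defect`).  There `K = χ V D′⁻¹ χ` with `χ` the `0/1` diagonal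
projection onto the defect index set `Z = {i | p i}`, so every column of `K` outside `Z` vanishes.
For such a `K` the matrix `1 + K` is block-triangular for the partition `(Z, Zᶜ)` with identity
`Zᶜ`-block, hence `det (1 + K)` is the determinant of the `Z × Z` block
(`det_one_add_eq_det_toSquareBlockProp`, from Mathlib's `Matrix.twoBlockTriangular_det'`), and
Hadamard's inequality (`Literature.Analysis.Matrix.norm_det_sq_le_prod_sum_sq`) on that block gives

  `‖det (1 + K)‖ ≤ ∏_{i ∈ Z} √(∑_{j ∈ Z} ‖(1 + K) i j‖²)`      (`norm_det_one_add_le_of_supported`).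

If moreover `‖K i j‖ ≤ κ` on `Z × Z` (`κ ≥ 0`), each `Z`-row satisfies
`∑_{j ∈ Z} ‖δ_ij + K i j‖² ≤ 1 + 2κ + |Z| κ² ≤ (1 + √|Z| κ)²`, whence
`‖det (1 + K)‖ ≤ (1 + √|Z| κ) ^ |Z|` (`norm_det_one_add_le_of_supported_of_entry_le`).
Folklore (Hadamard's inequality, J. Hadamard 1893); pure finite-dimensional linear algebra, no
definitions.
-/

namespace Summit.QuantumFields.QCD.Cruxes.StableActionBridge.Sketch

open Finset

/-- **Block reduction.** If every column of `K` outside `{i | p i}` vanishes, then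
`det (1 + K)` equals the determinant of the `p`-block of `1 + K`: the matrix `1 + K` is
block-triangular with identity complementary block. -/
theorem det_one_add_eq_det_toSquareBlockProp {n : Type*} [Fintype n] [DecidableEq n]
    (K : Matrix n n ℂ) (p : n → Prop) [DecidablePred p] (hK : ∀ i j, ¬ p j → K i j = 0) :
    (1 + K).det = ((1 + K).toSquareBlockProp p).det := by
  have hblock := Matrix.twoBlockTriangular_det' (1 + K) p (fun i hi j hj => by
    have hij : i ≠ j := fun h => hj (h ▸ hi)
    rw [Matrix.add_apply, Matrix.one_apply_ne hij, hK i j hj, add_zero])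
  have hcompl : Matrix.toSquareBlockProp (1 + K) (fun i => ¬ p i) = 1 := by
    ext i j
    rw [Matrix.toSquareBlockProp_def, Matrix.of_apply, Matrix.add_apply, hK (↑i) (↑j) j.2,
      add_zero]
    simp only [Matrix.one_apply, Subtype.ext_iff]
  rw [hblock, hcompl, Matrix.det_one, mul_one]

/-- **Hadamard bound on the supported block** (subtype-indexed form): if every column of `K`
outside `{i | p i}` vanishes, then `‖det (1 + K)‖ ≤ ∏_{i : p} √(∑_{j : p} ‖(1 + K) i j‖²)`. -/
theorem norm_det_one_add_le_prod_sqrt_subtype {n : Type*} [Fintype n] [DecidableEq n]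
    (K : Matrix n n ℂ) (p : n → Prop) [DecidablePred p] (hK : ∀ i j, ¬ p j → K i j = 0) :
    ‖(1 + K).det‖ ≤ ∏ i : {a // p a}, √(∑ j : {a // p a}, ‖(1 + K) i j‖ ^ 2) := by
  rw [det_one_add_eq_det_toSquareBlockProp K p hK]
  have h2 := Literature.Analysis.Matrix.norm_det_sq_le_prod_sum_sq ((1 + K).toSquareBlockProp p)
  simp only [Matrix.toSquareBlockProp_def, Matrix.of_apply] at h2 ⊢
  calc ‖(Matrix.of fun i j : {a // p a} => (1 + K) ↑i ↑j).det‖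
      = √(‖(Matrix.of fun i j : {a // p a} => (1 + K) ↑i ↑j).det‖ ^ 2) :=
        (Real.sqrt_sq (norm_nonneg _)).symm
    _ ≤ √(∏ i : {a // p a}, ∑ j : {a // p a}, ‖(1 + K) i j‖ ^ 2) := Real.sqrt_le_sqrt h2
    _ = ∏ i : {a // p a}, √(∑ j : {a // p a}, ‖(1 + K) i j‖ ^ 2) :=
        Real.sqrt_prod _ fun i _ => Finset.sum_nonneg fun j _ => by positivity

/-- **Row bound.** If `‖K i j‖ ≤ κ` on `{p} × {p}` with `κ ≥ 0`, then for `i` with `p i` the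
`p`-restricted `ℓ²` norm of the `i`-th row of `1 + K` is at most `1 + √|{p}| · κ`:
`∑_{j : p} ‖δ_ij + K i j‖² ≤ 1 + 2‖K i i‖ + ∑_{j : p} ‖K i j‖² ≤ 1 + 2κ + |{p}| κ² ≤ (1 + √|{p}| κ)²`. -/
theorem sqrt_sum_norm_one_add_sq_le {n : Type*} [Fintype n] [DecidableEq n]
    (K : Matrix n n ℂ) (p : n → Prop) [DecidablePred p] {κ : ℝ} (hκ : 0 ≤ κ)
    (hb : ∀ i j, p i → p j → ‖K i j‖ ≤ κ) (i : {a // p a}) :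
    √(∑ j : {a // p a}, ‖(1 + K) i j‖ ^ 2) ≤ 1 + √(Fintype.card {a // p a} : ℝ) * κ := by
  rw [Real.sqrt_le_left (by positivity)]
  have hN : (1 : ℝ) ≤ Fintype.card {a // p a} := by
    exact_mod_cast Fintype.card_pos_iff.2 ⟨i⟩
  have hsN : 1 ≤ √(Fintype.card {a // p a} : ℝ) := Real.one_le_sqrt.2 hN
  have hsN2 : √(Fintype.card {a // p a} : ℝ) ^ 2 = Fintype.card {a // p a} :=
    Real.sq_sqrt (Nat.cast_nonneg _)
  -- split both row sums at the diagonal entry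
  have hS := Finset.add_sum_erase Finset.univ (fun j : {a // p a} => ‖(1 + K) i j‖ ^ 2)
    (Finset.mem_univ i)
  have hT := Finset.add_sum_erase Finset.univ (fun j : {a // p a} => ‖K i j‖ ^ 2)
    (Finset.mem_univ i)
  have herase : ∑ j ∈ Finset.univ.erase i, ‖(1 + K) i j‖ ^ 2 =
      ∑ j ∈ Finset.univ.erase i, ‖K i j‖ ^ 2 := by
    refine Finset.sum_congr rfl fun j hj => ?_
    have hij : (i : n) ≠ j := fun h => (Finset.mem_erase.1 hj).1 (Subtype.ext h).symm
    rw [Matrix.add_apply, Matrix.one_apply_ne hij, zero_add]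
  rw [herase] at hS
  have hdiag : ‖(1 + K) i i‖ ≤ 1 + ‖K i i‖ := by
    rw [Matrix.add_apply, Matrix.one_apply_eq]
    exact (norm_add_le _ _).trans_eq (by rw [norm_one])
  have hdiag2 : ‖(1 + K) i i‖ ^ 2 ≤ (1 + ‖K i i‖) ^ 2 :=
    pow_le_pow_left₀ (norm_nonneg _) hdiag 2
  have hii : ‖K i i‖ ≤ κ := hb _ _ i.2 i.2
  have hsum : ∑ j : {a // p a}, ‖K i j‖ ^ 2 ≤ Fintype.card {a // p a} * κ ^ 2 := by
    calc ∑ j : {a // p a}, ‖K i j‖ ^ 2 ≤ ∑ _j : {a // p a}, κ ^ 2 :=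
          Finset.sum_le_sum fun j _ => pow_le_pow_left₀ (norm_nonneg _) (hb _ _ i.2 j.2) 2
      _ = Fintype.card {a // p a} * κ ^ 2 := by
          rw [Finset.sum_const, Finset.card_univ, nsmul_eq_mul]
  have hE : 0 ≤ ∑ j ∈ Finset.univ.erase i, ‖K i j‖ ^ 2 :=
    Finset.sum_nonneg fun _ _ => by positivity
  nlinarith [hS, hT, hdiag2, hii, hsum, hE, mul_nonneg (sub_nonneg.2 hsN) hκ, hsN2,
    norm_nonneg (K i i), sq_nonneg κ]

/-- **Supported-determinant Hadamard bound** (stub `norm_det_one_add_le_of_supported`, W2a).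
If every column of `K` outside `Z = {i | p i}` vanishes, then
`‖det (1 + K)‖ ≤ ∏_{i ∈ Z} √(∑_{j ∈ Z} ‖(1 + K) i j‖²)`: `1 + K` is block-triangular with identity
`Zᶜ`-block, and Hadamard's inequality bounds the determinant of the `Z × Z` block by the product of
the `ℓ²` norms of its rows.  Folklore (Hadamard 1893). -/
theorem norm_det_one_add_le_of_supported :
    ∀ (n : Type) [Fintype n] [DecidableEq n] (K : Matrix n n ℂ) (p : n → Prop) [DecidablePred p],
      (∀ i j, ¬ p j → K i j = 0) →
        ‖(1 + K).det‖ ≤ ∏ i ∈ Finset.univ.filter p,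
          Real.sqrt (∑ j ∈ Finset.univ.filter p, ‖(1 + K) i j‖ ^ 2) := by
  intro n _ _ K p _ hK
  have hmem : ∀ x, x ∈ Finset.univ.filter p ↔ p x := fun x => by
    rw [Finset.mem_filter, and_iff_right (Finset.mem_univ x)]
  have e1 : ∏ i ∈ Finset.univ.filter p, Real.sqrt (∑ j ∈ Finset.univ.filter p, ‖(1 + K) i j‖ ^ 2)
      = ∏ i : {a // p a}, √(∑ j : {a // p a}, ‖(1 + K) i j‖ ^ 2) := by
    rw [Finset.prod_subtype (F := inferInstance) (Finset.univ.filter p) hmem]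
    refine Finset.prod_congr rfl fun i _ => ?_
    rw [Finset.sum_subtype (F := inferInstance) (Finset.univ.filter p) hmem]
  rw [e1]
  exact norm_det_one_add_le_prod_sqrt_subtype K p hK

/-- **Entry-bound corollary** (stub `norm_det_one_add_le_of_supported_of_entry_le`, W2b).
If every column of `K` outside `Z = {i | p i}` vanishes and `‖K i j‖ ≤ κ` on `Z × Z` (`κ ≥ 0`),
then `‖det (1 + K)‖ ≤ (1 + √|Z| · κ) ^ |Z|`: each `Z`-row of `1 + K` has `Z`-restricted `ℓ²` norm
`≤ ‖e_i‖ + ‖K_i‖ ≤ 1 + √|Z| κ`, and there are `|Z|` rows. -/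
theorem norm_det_one_add_le_of_supported_of_entry_le :
    ∀ (n : Type) [Fintype n] [DecidableEq n] (K : Matrix n n ℂ) (p : n → Prop) [DecidablePred p]
      (κ : ℝ), 0 ≤ κ → (∀ i j, ¬ p j → K i j = 0) → (∀ i j, p i → p j → ‖K i j‖ ≤ κ) →
        ‖(1 + K).det‖ ≤
          (1 + Real.sqrt ((Finset.univ.filter p).card : ℝ) * κ) ^ (Finset.univ.filter p).card := by
  intro n _ _ K p _ κ hκ hK hb
  rw [← Fintype.card_subtype p]
  refine (norm_det_one_add_le_prod_sqrt_subtype K p hK).trans ?_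
  calc ∏ i : {a // p a}, √(∑ j : {a // p a}, ‖(1 + K) i j‖ ^ 2)
      ≤ ∏ _i : {a // p a}, (1 + √(Fintype.card {a // p a} : ℝ) * κ) :=
        Finset.prod_le_prod (fun i _ => Real.sqrt_nonneg _)
          fun i _ => sqrt_sum_norm_one_add_sq_le K p hκ hb i
    _ = (1 + √(Fintype.card {a // p a} : ℝ) * κ) ^ Fintype.card {a // p a} := by
        rw [Finset.prod_const, Finset.card_univ]

end Summit.QuantumFields.QCD.Cruxes.StableActionBridge.Sketch
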